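import Mathlib
import Literature.Computability.AlgebraicComplexity.BorderApolarityLimits
import Literature.Computability.AlgebraicComplexity.TensorApolarityForms
import Summits.MatrixMultiplication.MatrixMultiplication.Theorems.FidelityWitnessesFidelityGapThreeSeventeenStubFatBorderApolarityLimits
import Summits.MatrixMultiplication.MatrixMultiplication.Theorems.FidelityWitnessesFidelityGapThreeSeventeenStubFatBorderApolarityForms
import Summits.MatrixMultiplication.MatrixMultiplication.Theorems.FidelityWitnessesFidelityGapThreeSeventeenStubFatBorderApolarityRank

/-!
# Borel-fixed border apolarity at `(⟨3,3,3⟩, 17)` — part 3: moving points perturbed towards a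
# configuration in general position

Crux `stmt-MatrixMultiplication-4958` (`FidelityWitnesses.FidelityGapThreeSeventeen`), line
`punctual-saturation`, stub `stub_borelFixedApolarity` (helper file; general, reusable).

For a block-multigraded polynomial ring `K[x_σ]`, moving points `q_ρ(ε) ∈ K[ε]^σ` (`ρ < r`) and a
configuration `x_ρ ∈ K^σ` imposing `min (r, dim S_m)` independent conditions on the piece `S_m`,
the PERTURBED points `p_ρ = q_ρ + ε^M x_ρ` (`M` beyond the degrees of `q`):

* `Moving.finrank_Ilim_add_min` — the limit piece `I_m = lim_{ε→0} I(p(ε))_m` has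
  `dim I_m + min (r, dim S_m) = dim S_m` (the generic Hilbert function; extends file C's
  `finrank_Ilim_add`, which is the case `r ≤ dim S_m`);
* `Moving.exists_ne_zero_eval_imp` — off the roots of ONE non-zero polynomial `Δ_m(ε)` the
  SPECIALISED points `p_ρ(z) ∈ K^σ` impose `min (r, dim S_m)` conditions on `S_m` (a `k × k`
  matrix of values, read through a retraction onto the span at `x`, is `≡ ε^N · 1` modulo lower
  degree: `det_ne_zero_of_degree_lt`);
* `Moving.exists_seq_tendsto` — over `ℂ`: a sequence `z_k → 0` such that every configuration
  `p(z_k)` is in general position in EVERY degree (the countably many bad values — roots of the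
  `Δ_m` — have dense complement);
* `Moving.exists_coeff_tendsto` — every `f ∈ I_m` is a coefficientwise limit of forms of weight
  `m` vanishing at `p(z_k)` (specialise a `K[ε]`-form `F` with `F(0) = f`).

This is the dictionary "approximate decomposition over `ℂ[ε]` ↔ sequences of point configurations"
behind the sequential Slip form of border apolarity (Buczyńska–Buczyński 2021 Thm 1.2 / §3;
Conner–Harper–Landsberg 2023 §2.3). Registered sub-goal: `stub_borelFixedApolarity_moving`.
-/

noncomputable section

namespace Summit.MatrixMultiplication.MatrixMultiplication.Theorems.PunctualSaturation

-- single-conjunct summit: the `Summit.<S>.<P>` prefix repeats `MatrixMultiplication` by design (D-0017)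
set_option linter.dupNamespace false

open scoped BigOperators Polynomial Topology
open Polynomial Module Filter
open Literature.Computability.AlgebraicComplexity
open Literature.Computability.AlgebraicComplexity.TensorApolarity
open Summit.MatrixMultiplication.MatrixMultiplication.Theorems.SymbolicSquare.FatBorder

namespace Moving

universe u

/-! ## Two polynomial bookkeeping lemmas -/

section Poly

variable {K : Type u} [Field K]

/-- `deg f < N` as soon as `deg f ≤ N` and `f[ε^N] = 0`. [folklore] -/
theorem degree_lt_of_natDegree_le_of_coeff_eq_zero {f : K[X]} {N : ℕ} (h1 : f.natDegree ≤ N)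
    (h2 : f.coeff N = 0) : f.degree < N := by
  rw [degree_lt_iff_coeff_zero]
  intro m hm
  rcases hm.lt_or_eq with h | h
  · exact coeff_eq_zero_of_natDegree_lt (h1.trans_lt h)
  · rw [← h, h2]

/-- Specialising `ε ↦ z` after substituting moving points = substituting the specialised points.
[folklore] -/
theorem eval_aeval {σ : Type*} (P : σ → K[X]) (z : K) (G : MvPolynomial σ K) :
    (MvPolynomial.aeval P G).eval z = MvPolynomial.aeval (fun v => (P v).eval z) G := by
  have h := congrArg (fun φ : MvPolynomial σ K →ₐ[K] K => φ G)
    (MvPolynomial.comp_aeval (Polynomial.aeval z : K[X] →ₐ[K] K) (f := P))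
  simpa [Polynomial.coe_aeval_eq_eval] using h

/-- Specialising `ε ↦ z` coefficientwise commutes with substituting points. [folklore] -/
theorem eval_map_evalRingHom {σ : Type*} (P : σ → K[X]) (z : K) (F : MvPolynomial σ K[X]) :
    MvPolynomial.eval (fun v => (P v).eval z) (MvPolynomial.map (evalRingHom z) F) =
      (MvPolynomial.eval P F).eval z := by
  rw [MvPolynomial.eval_map, ← coe_evalRingHom]
  change _ = evalRingHom z (MvPolynomial.eval₂ (RingHom.id _) P F)
  rw [MvPolynomial.eval₂_comp_left, RingHom.comp_id]
  rfl

end Poly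

/-! ## The setting: a block grading, moving points, a limit configuration -/

variable {K : Type u} [Field K]
variable {σ ι : Type} [Fintype σ] [Fintype ι] (w : σ → ι → ℕ) (m : ι → ℕ) {r : ℕ}

variable {w m}

/-- Rank–nullity at a configuration `y` for the evaluation map of coefficient vectors of weight `m`:
`rank ev_y + dim I(y)_m = dim S_m`. [folklore] -/
theorem finrank_range_ev_add (hw : ∀ v, ∑ l, w v l = 1) (y : Fin r → σ → K) :
    finrank K (LinearMap.range
      (LinearMap.pi fun ρ => (MvPolynomial.aeval (y ρ)).toLinearMap ∘ₗ form w m K)) +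
      finrank K ↥(MvPolynomial.weightedHomogeneousSubmodule K w m ⊓
        ⨅ ρ, LinearMap.ker (MvPolynomial.aeval (y ρ)).toLinearMap) =
      finrank K (MvPolynomial.weightedHomogeneousSubmodule K w m) :=
  finrank_range_pi_add w m hw fun ρ => (MvPolynomial.aeval (y ρ)).toLinearMap

/-- `rank ev_y ≤ r`. [folklore] -/
theorem finrank_range_ev_le (y : Fin r → σ → K) :
    finrank K (LinearMap.range
      (LinearMap.pi fun ρ => (MvPolynomial.aeval (y ρ)).toLinearMap ∘ₗ form w m K)) ≤ r := by
  simpa using Submodule.finrank_le (LinearMap.range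
    (LinearMap.pi fun ρ => (MvPolynomial.aeval (y ρ)).toLinearMap ∘ₗ form w m K))

/-! ## The generic Hilbert function of the limit pieces -/

/-- **`dim I_m + min (r, dim S_m) = dim S_m`** for the perturbed moving points `p = q + ε^M x`
(`M` beyond the degrees of `q`) as soon as the limit configuration `x` imposes `min (r, dim S_m)`
independent conditions on `S_m`. [cite: ConnerHarperLandsberg2023, §2.3] -/
theorem finrank_Ilim_add_min (hw : ∀ v, ∑ l, w v l = 1) {q : Fin r → σ → K[X]}
    {x : Fin r → σ → K} {M : ℕ} (hq : ∀ ρ v, (q ρ v).natDegree < M)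
    (hx : finrank K ↥(MvPolynomial.weightedHomogeneousSubmodule K w m ⊓
        ⨅ ρ, LinearMap.ker (MvPolynomial.aeval (x ρ)).toLinearMap) +
      min r (finrank K (MvPolynomial.weightedHomogeneousSubmodule K w m)) =
      finrank K (MvPolynomial.weightedHomogeneousSubmodule K w m)) :
    finrank K (Ilim K w m (fun ρ v => q ρ v + X ^ M * C (x ρ v))) +
      min r (finrank K (MvPolynomial.weightedHomogeneousSubmodule K w m)) =
      finrank K (MvPolynomial.weightedHomogeneousSubmodule K w m) := by
  classical
  set p : Fin r → σ → K[X] := fun ρ v => q ρ v + X ^ M * C (x ρ v) with hp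
  have hcard := finrank_weightedHomogeneousSubmodule_eq_card (K := K) w m hw
  have h1 := card_le_finrank_vanGen_add (FractionRing K[X]) (valMat w m p)
  rw [Fintype.card_fin] at h1
  have h1' : finrank (FractionRing K[X]) (vanGen (FractionRing K[X]) (valMat w m p)) ≤
      Fintype.card (Mon w m) := by
    simpa using Submodule.finrank_le (vanGen (FractionRing K[X]) (valMat w m p))
  have hP : ∀ ρ v, (p ρ v).natDegree ≤ M ∧ (p ρ v).coeff M = x ρ v :=
    fun ρ v => natDegree_pert_le hq x ρ v
  have hsym := finrank_range_ev_add (m := m) hw x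
  have h2 := finrank_vanGen_add_finrank_range_le (FractionRing K[X]) (valMat w m p)
    (LinearMap.pi fun ρ => (MvPolynomial.aeval (x ρ)).toLinearMap ∘ₗ form w m K)
    (fun _ => (∑ l, m l) * M) fun g ρ => by
      rw [sum_C_mul_valMat]
      have := natDegree_aeval_le_and_coeff w hw (form_mem w m g) (hP ρ)
      simpa [MvPolynomial.coe_aeval_eq_eval] using this
  rw [finrank_Ilim]
  omega

/-! ## General position of the specialised points off the roots of one polynomial -/

/-- **Off the roots of one non-zero polynomial `Δ_m` the specialised points `p_ρ(z)` impose
`min (r, dim S_m)` independent conditions on `S_m`.** [cite: ConnerHarperLandsberg2023, §2.3] -/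
theorem exists_ne_zero_eval_imp (hw : ∀ v, ∑ l, w v l = 1) {q : Fin r → σ → K[X]}
    {x : Fin r → σ → K} {M : ℕ} (hq : ∀ ρ v, (q ρ v).natDegree < M)
    (hx : finrank K ↥(MvPolynomial.weightedHomogeneousSubmodule K w m ⊓
        ⨅ ρ, LinearMap.ker (MvPolynomial.aeval (x ρ)).toLinearMap) +
      min r (finrank K (MvPolynomial.weightedHomogeneousSubmodule K w m)) =
      finrank K (MvPolynomial.weightedHomogeneousSubmodule K w m)) :
    ∃ Δ : K[X], Δ ≠ 0 ∧ ∀ z : K, Δ.eval z ≠ 0 →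
      finrank K ↥(MvPolynomial.weightedHomogeneousSubmodule K w m ⊓
          ⨅ ρ, LinearMap.ker (MvPolynomial.aeval
            (fun v => (q ρ v + X ^ M * C (x ρ v)).eval z)).toLinearMap) +
        min r (finrank K (MvPolynomial.weightedHomogeneousSubmodule K w m)) =
        finrank K (MvPolynomial.weightedHomogeneousSubmodule K w m) := by
  classical
  set p : Fin r → σ → K[X] := fun ρ v => q ρ v + X ^ M * C (x ρ v) with hp
  set n := finrank K (MvPolynomial.weightedHomogeneousSubmodule K w m) with hn
  set k := min r n with hk
  set N := (∑ l, m l) * M with hN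
  have hP : ∀ ρ v, (p ρ v).natDegree ≤ M ∧ (p ρ v).coeff M = x ρ v :=
    fun ρ v => natDegree_pert_le hq x ρ v
  -- the evaluation maps of coefficient vectors at a configuration
  obtain ⟨evC, hevC⟩ : ∃ e : (Fin r → σ → K) → (Mon w m → K) →ₗ[K] (Fin r → K),
      e = fun y => LinearMap.pi fun ρ => (MvPolynomial.aeval (y ρ)).toLinearMap ∘ₗ form w m K :=
    ⟨_, rfl⟩
  have evC_apply : ∀ (y : Fin r → σ → K) (g : Mon w m → K) (ρ : Fin r),
      evC y g ρ = MvPolynomial.aeval (y ρ) (form w m K g) := fun _ _ _ => by rw [hevC]; rfl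
  -- a basis of the span at `x`, realised by coefficient vectors `g j`, and a retraction `Φ`
  have hUk : finrank K (LinearMap.range (evC x)) = k := by
    have := finrank_range_ev_add (m := m) hw x
    rw [hevC]
    beta_reduce
    omega
  set U := LinearMap.range (evC x) with hU
  let b := Module.finBasisOfFinrankEq K U hUk
  have hmem : ∀ j, ∃ g : Mon w m → K, evC x g = (b j : Fin r → K) :=
    fun j => LinearMap.mem_range.1 (b j).2
  choose g hg using hmem
  obtain ⟨π, hπ⟩ := LinearMap.exists_leftInverse_of_injective U.subtype (Submodule.ker_subtype U)
  set Φ : (Fin r → K) →ₗ[K] (Fin k → K) := b.equivFun.toLinearMap ∘ₗ π with hΦ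
  have hΦb : ∀ j i, Φ (evC x (g j)) i = if j = i then 1 else 0 := by
    intro j i
    have hπb : π (b j : Fin r → K) = b j := LinearMap.congr_fun hπ (b j)
    rw [hg j, hΦ, LinearMap.comp_apply, hπb]
    simp
  -- the unit vectors and the matrix of `Φ`
  set e : Fin r → Fin r → K := fun ρ j => if ρ = j then 1 else 0 with he
  have hΦsum : ∀ (v : Fin r → K) (i : Fin k), Φ v i = ∑ ρ, v ρ * Φ (e ρ) i := by
    intro v i
    rw [LinearMap.pi_apply_eq_sum_univ Φ v, Finset.sum_apply]
    simp [he]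
  -- the polynomial matrix and its top coefficients
  set Mat : Matrix (Fin k) (Fin k) K[X] := Matrix.of fun j i =>
    ∑ ρ, MvPolynomial.aeval (p ρ) (form w m K (g j)) * C (Φ (e ρ) i) with hMat
  have htop : ∀ j ρ, (MvPolynomial.aeval (p ρ) (form w m K (g j))).natDegree ≤ N ∧
      (MvPolynomial.aeval (p ρ) (form w m K (g j))).coeff N = evC x (g j) ρ := by
    intro j ρ
    have := natDegree_aeval_le_and_coeff w hw (form_mem w m (g j)) (hP ρ)
    simpa [evC_apply, MvPolynomial.coe_aeval_eq_eval] using this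
  have hentry : ∀ j i, (Mat j i).natDegree ≤ N ∧ (Mat j i).coeff N = if j = i then 1 else 0 := by
    intro j i
    simp only [hMat, Matrix.of_apply]
    refine ⟨natDegree_sum_le_of_forall_le _ _ fun ρ _ =>
      (natDegree_mul_C_le _ _).trans (htop j ρ).1, ?_⟩
    rw [finsetSum_coeff, ← hΦb j i, hΦsum]
    refine Finset.sum_congr rfl fun ρ _ => ?_
    rw [coeff_mul_C, (htop j ρ).2]
  have hdet : Mat.det ≠ 0 := by
    refine det_ne_zero_of_degree_lt N Mat (fun i => ?_) (fun i j hij => ?_)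
    · refine degree_lt_of_natDegree_le_of_coeff_eq_zero
        ((natDegree_sub_le_of_le (hentry i i).1 (natDegree_X_pow_le N)).trans (max_self N).le) ?_
      rw [coeff_sub, (hentry i i).2, if_pos rfl, coeff_X_pow_self, sub_self]
    · refine degree_lt_of_natDegree_le_of_coeff_eq_zero (hentry i j).1 ?_
      rw [(hentry i j).2, if_neg hij]
  refine ⟨Mat.det, hdet, fun z hz => ?_⟩
  -- specialise at `z`
  set y : Fin r → σ → K := fun ρ v => (p ρ v).eval z with hy
  set A : Matrix (Fin k) (Fin k) K := Matrix.of fun j i => Φ (evC y (g j)) i with hA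
  have hAM : (evalRingHom z).mapMatrix Mat = A := by
    ext j i
    simp only [RingHom.mapMatrix_apply, Matrix.map_apply, hMat, hA, Matrix.of_apply, coe_evalRingHom,
      eval_finsetSum, eval_mul, eval_C, hΦsum (evC y (g j)) i]
    refine Finset.sum_congr rfl fun ρ _ => ?_
    rw [evC_apply, eval_aeval]
  have hAdet : A.det ≠ 0 := by
    rw [← hAM, ← RingHom.map_det]
    exact hz
  have hrows : LinearIndependent K A.row :=
    Matrix.linearIndependent_rows_iff_isUnit.2
      ((Matrix.isUnit_iff_isUnit_det A).2 (isUnit_iff_ne_zero.2 hAdet))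
  have hrow : A.row = fun j => Φ (evC y (g j)) := by
    funext j i; simp [hA, Matrix.row]
  rw [hrow] at hrows
  have hli : LinearIndependent K (fun j => evC y (g j)) := LinearIndependent.of_comp Φ hrows
  -- hence `rank ev_y ≥ k`
  set G : Fin k → LinearMap.range (evC y) :=
    fun j => ⟨evC y (g j), LinearMap.mem_range_self _ _⟩ with hG
  have hG' : LinearIndependent K G :=
    LinearIndependent.of_comp (LinearMap.range (evC y)).subtype hli
  have hk' : k ≤ finrank K (LinearMap.range (evC y)) := by
    simpa using hG'.fintype_card_le_finrank
  have hsym := finrank_range_ev_add (m := m) hw y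
  have hle := finrank_range_ev_le (w := w) (m := m) y
  rw [hevC] at hk'
  beta_reduce at hk'
  change finrank K ↥(MvPolynomial.weightedHomogeneousSubmodule K w m ⊓
      ⨅ ρ, LinearMap.ker (MvPolynomial.aeval (y ρ)).toLinearMap) + min r n = n
  omega

/-! ## Over `ℂ`: a sequence of specialisations in general position in every degree -/

/-- **A sequence `z_k → 0` off all the bad values**: every configuration `p(z_k)` imposes
`min (r, dim S_m)` independent conditions on every piece `S_m`. [cite: BuczynskaBuczynski2021, Thm 1.2] -/
theorem exists_seq_tendsto {w : σ → ι → ℕ} (hw : ∀ v, ∑ l, w v l = 1) {q : Fin r → σ → ℂ[X]}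
    {x : Fin r → σ → ℂ} {M : ℕ} (hq : ∀ ρ v, (q ρ v).natDegree < M)
    (hx : ∀ m, finrank ℂ ↥(MvPolynomial.weightedHomogeneousSubmodule ℂ w m ⊓
        ⨅ ρ, LinearMap.ker (MvPolynomial.aeval (x ρ)).toLinearMap) +
      min r (finrank ℂ (MvPolynomial.weightedHomogeneousSubmodule ℂ w m)) =
      finrank ℂ (MvPolynomial.weightedHomogeneousSubmodule ℂ w m)) :
    ∃ z : ℕ → ℂ, Tendsto z atTop (𝓝 0) ∧ ∀ k m,
      finrank ℂ ↥(MvPolynomial.weightedHomogeneousSubmodule ℂ w m ⊓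
          ⨅ ρ, LinearMap.ker (MvPolynomial.aeval
            (fun v => (q ρ v + X ^ M * C (x ρ v)).eval (z k))).toLinearMap) +
        min r (finrank ℂ (MvPolynomial.weightedHomogeneousSubmodule ℂ w m)) =
        finrank ℂ (MvPolynomial.weightedHomogeneousSubmodule ℂ w m) := by
  choose Δ hΔ0 hΔ using fun m => exists_ne_zero_eval_imp (m := m) hw hq (hx m)
  -- the good values are dense: the bad ones are the countably many roots of the `Δ m`
  have hdense : Dense {z : ℂ | ∀ m, (Δ m).eval z ≠ 0} := by
    have hset : {z : ℂ | ∀ m, (Δ m).eval z ≠ 0} = (⋃ m, {z | (Δ m).IsRoot z})ᶜ := by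
      ext z; simp [Polynomial.IsRoot]
    rw [hset]
    exact Set.Countable.dense_compl ℂ
      (Set.countable_iUnion fun m => (Polynomial.finite_setOf_isRoot (hΔ0 m)).countable)
  have hz : ∀ k : ℕ, ∃ z : ℂ, ‖z‖ < 1 / ((k : ℝ) + 1) ∧ ∀ m, (Δ m).eval z ≠ 0 := fun k => by
    have hk : (0 : ℝ) < 1 / ((k : ℝ) + 1) := by positivity
    obtain ⟨z, hz, hzU⟩ := hdense.exists_mem_open Metric.isOpen_ball ⟨0, Metric.mem_ball_self hk⟩
    exact ⟨z, by simpa using hzU, hz⟩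
  choose z hzn hzΔ using hz
  refine ⟨z, ?_, fun k m => hΔ m (z k) (hzΔ k m)⟩
  exact squeeze_zero_norm (fun k => (hzn k).le) tendsto_one_div_add_atTop_nhds_zero_nat

/-! ## Elements of the limit piece are limits of vanishing forms -/

omit [Fintype σ] [Fintype ι] in
/-- Specialising coefficients preserves weights. [folklore] -/
theorem map_mem_weightedHomogeneousSubmodule {R S : Type*} [CommSemiring R] [CommSemiring S]
    (φ : R →+* S) {w : σ → ι → ℕ} {m : ι → ℕ} {F : MvPolynomial σ R}
    (hF : F ∈ MvPolynomial.weightedHomogeneousSubmodule R w m) :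
    MvPolynomial.map φ F ∈ MvPolynomial.weightedHomogeneousSubmodule S w m := by
  intro d hd
  rw [MvPolynomial.coeff_map] at hd
  exact hF fun h => hd (by rw [h, map_zero])

/-- **Every `f ∈ I_m` is a coefficientwise limit of forms of weight `m` vanishing at the
specialised points `p(z_k)`**, for any `z_k → 0`. [cite: BuczynskaBuczynski2021, Thm 1.2] -/
theorem exists_coeff_tendsto {w : σ → ι → ℕ} (hw : ∀ v, ∑ l, w v l = 1) {m : ι → ℕ}
    (p : Fin r → σ → ℂ[X]) {z : ℕ → ℂ} (hz : Tendsto z atTop (𝓝 0)) {f : MvPolynomial σ ℂ}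
    (hf : f ∈ Ilim ℂ w m p) :
    ∃ fseq : ℕ → MvPolynomial σ ℂ,
      (∀ k, fseq k ∈ MvPolynomial.weightedHomogeneousSubmodule ℂ w m ⊓
        ⨅ ρ, LinearMap.ker (MvPolynomial.aeval (fun v => (p ρ v).eval (z k))).toLinearMap) ∧
      ∀ d : σ →₀ ℕ, Tendsto (fun k => MvPolynomial.coeff d (fseq k)) atTop
        (𝓝 (MvPolynomial.coeff d f)) := by
  obtain ⟨F, hF, hF0, rfl⟩ := (mem_Ilim_iff hw).1 hf
  refine ⟨fun k => MvPolynomial.map (evalRingHom (z k)) F, fun k => ⟨?_, ?_⟩, fun d => ?_⟩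
  · exact map_mem_weightedHomogeneousSubmodule _ hF
  · refine (Submodule.mem_iInf _).2 fun ρ => ?_
    rw [LinearMap.mem_ker, AlgHom.toLinearMap_apply]
    change MvPolynomial.eval (fun v => (p ρ v).eval (z k)) (MvPolynomial.map (evalRingHom (z k)) F) = 0
    rw [eval_map_evalRingHom, hF0 ρ, eval_zero]
  · simp only [MvPolynomial.coeff_map, coe_evalRingHom]
    rw [Polynomial.constantCoeff_apply, Polynomial.coeff_zero_eq_eval_zero]
    exact ((MvPolynomial.coeff d F).continuous.tendsto 0).comp hz

end Moving

/-- **Registered sub-goal `stub_borelFixedApolarity_moving` of `stub_borelFixedApolarity`**: over `ℂ`,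
moving points perturbed by `ε^M` towards a configuration in general position in every degree
specialise, along a sequence `z_k → 0`, to configurations in general position in every degree
(the general-position half of the sequential Slip form of border apolarity).
[cite: BuczynskaBuczynski2021, Thm 1.2] -/
theorem stub_borelFixedApolarity_moving :
    ∀ (σ ι : Type) [Fintype σ] [Fintype ι] (w : σ → ι → ℕ), (∀ v, ∑ l, w v l = 1) →
      ∀ (r M : ℕ) (q : Fin r → σ → Polynomial ℂ) (x : Fin r → σ → ℂ),
        (∀ ρ v, (q ρ v).natDegree < M) →
        (∀ m, Module.finrank ℂ ↥(MvPolynomial.weightedHomogeneousSubmodule ℂ w m ⊓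
            ⨅ ρ, LinearMap.ker (MvPolynomial.aeval (x ρ)).toLinearMap) +
          min r (Module.finrank ℂ ↥(MvPolynomial.weightedHomogeneousSubmodule ℂ w m)) =
          Module.finrank ℂ ↥(MvPolynomial.weightedHomogeneousSubmodule ℂ w m)) →
        ∃ z : ℕ → ℂ, Filter.Tendsto z Filter.atTop (nhds 0) ∧ ∀ k m,
          Module.finrank ℂ ↥(MvPolynomial.weightedHomogeneousSubmodule ℂ w m ⊓
              ⨅ ρ, LinearMap.ker (MvPolynomial.aeval
                (fun v => (q ρ v + Polynomial.X ^ M * Polynomial.C (x ρ v)).eval (z k))).toLinearMap) +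
            min r (Module.finrank ℂ ↥(MvPolynomial.weightedHomogeneousSubmodule ℂ w m)) =
            Module.finrank ℂ ↥(MvPolynomial.weightedHomogeneousSubmodule ℂ w m) :=
  fun _ _ _ _ _ hw _ _ _ _ hq hx => Moving.exists_seq_tendsto hw hq hx

end Summit.MatrixMultiplication.MatrixMultiplication.Theorems.PunctualSaturation

end
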